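import Summits.Ventures.PercRepro2.CaseOneGadgetUWA1Pin
import Summits.Ventures.PercRepro2.CaseOneGlued

/-!
# The gadget `u ~ {w, a₁}`, `w ~ {u, a₂, o, b}` (uwa1): the top face in `e(w–a₂)` is a glued root-only instance
(blind cell PercRepro2, p1 g24; S5 §2.1 (K9) — the `(ii)` / `(ii-Q)` half of the uwa1 row by the face induction of
P1-FACE §4; own code)

Two transport lemmas for the face step: `gadgetUWA1_rootsOnly` — in the gadget every edge at `u` goes to `a₁` or to `w`,
the hypothesis `hroot` of the glued root-only class theorems `zSplitII_of_rootsOnly_glued₂` /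
`zSplitIIQ_of_rootsOnly_glued₂` (CaseOneGlued.lean) at `a₃ = u`; and `pin5A_update_wa2` — pinning the five gadget edges
forgets a prior update of `e(w–a₂)`, so the cell masses of the glued instance `p[ewa2 ↦ 1]` are those of `p`. With the
bridge `iiExpr_eq_iiA5` / `iiExprT_eq_iiqA5` (CaseOneGadgetUWA1Bridge.lean) they turn the class theorem at the glued
instance into the face value `iiA5(e₂ := 1) ≥ 0` / `iiqA5(e₂ := 1) ≥ 0` of the gadget polynomials. -/

namespace Summit.Ventures.PercRepro2

namespace CaseOne

section FaceA5
variable {V : Type*} {E : Type*} [Fintype E] [DecidableEq E] {R : Type*} [CommRing R]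
variable {ends : E → Sym2 V} {o a₁ a₂ b u w : V} {euw eua1 ewa2 ewo ewb : E}

omit [Fintype E] [DecidableEq E] in
/-- In the gadget every edge at `u` goes to `a₁` or to `w`: the `hroot` hypothesis of the glued root-only class
theorems at `a₃ = u`. -/
lemma gadgetUWA1_rootsOnly (h : IsGadgetUWA1 ends o a₁ a₂ b u w euw eua1 ewa2 ewo ewb) :
    ∀ e', u ∈ ends e' → ends e' = s(a₁, u) ∨ ends e' = s(w, u) := by
  intro e' he'
  rcases h.unique_u e' he' with rfl | rfl
  · exact Or.inr h.ends_uw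
  · exact Or.inl h.ends_ua1

omit [Fintype E] in
/-- Pinning the five gadget edges forgets a prior update of `e(w–a₂)`. -/
lemma pin5A_update_wa2 (p : E → R) (c : R) :
    pin5A (Function.update p ewa2 c) euw eua1 ewa2 ewo ewb = pin5A p euw eua1 ewa2 ewo ewb := by
  funext x
  unfold pin5A
  by_cases hx : x = ewa2
  · subst hx
    simp [Function.update_apply]
  · simp [Function.update_apply, hx]

end FaceA5

end CaseOne

end Summit.Ventures.PercRepro2
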